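/-
Literature file (hubbard-downfold router R2 «f at E_F» f-boxes and D10 magnetic members; hubbard-eph magnetic
controls): HUND'S RULES IN CLOSED FORM for an `l`-shell with `n` electrons, the LANDÉ FACTOR, and the FREE-ION
EFFECTIVE MAGNETON NUMBER `p = g √(J(J+1))` — with Kittel's lanthanide (Table 15.1) and iron-group (Table 15.2)
tables CERTIFIED entry by entry from exact rational arithmetic, the spin-only values, and the located use
(«μ_eff = 2.54 μ_B ⇒ stable Ce³⁺», Bauer et al. on CePt₃Si).
-/
import Mathlib.Analysis.SpecialFunctions.Pow.Real
import HarnessLib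

/-!
# Hund's rules, the Landé factor and the effective magneton number

Every heavy-fermion / rare-earth / iron-group row of this programme's validation set quotes a Curie–Weiss
EFFECTIVE MOMENT and reads a valence or spin state off it («μ_eff = 2.54 μ_B indicates a rather stable 3⁺ state
of Ce», Bauer et al. 2004; «μ_eff S = 1», «Eu²⁺ 7.94», «Nd³⁺ spectator 3.62», …). The dictionary behind those
sentences is Kittel's chapter on paramagnetism: the Landé equation (16)
`g = 1 + [J(J+1) + S(S+1) − L(L+1)] / [2J(J+1)]`, the effective number of Bohr magnetons (26)
`p = g [J(J+1)]^{1/2}` (Curie constant `∝ p²`), Hund's three rules for the ground term of a partly filled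
shell, Table 1 (trivalent lanthanides, `p(calc)` vs `p(exp)`) and Table 2 (iron group; orbital moment quenched,
`p = 2[S(S+1)]^{1/2}`).

This file makes the three Hund rules a CLOSED FORM in the shell angular momentum `l` and electron number `n`
(`0 ≤ n ≤ 4l + 2`): with `h = 2l + 1` orbitals,
* `S = n/2` for `n ≤ h`, else `(2h − n)/2` (rule 1: maximal spin);
* `L = n(h − n)/2` for `n ≤ h`, else `(n − h)(2h − n)/2` (rule 2: the `n` (resp. `n − h`) largest `m_l`
  values `l, l−1, …` summed);
* `J = L − S` for `n ≤ 2l` (less than half filled; then `L ≥ S`), else `L + S` (at half filling `L = 0`, `J = S`)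
  (rule 3);
and `p² = g² J(J+1)` is then a RATIONAL NUMBER for every ion, so each printed two-decimal `p(calc)` is certified
by squaring (no square roots needed).

Proved here:
* the ground terms of Kittel's Table 1 (`f¹ … f¹³`) and Table 2 (`d¹ … d⁹`) from the closed form
  (`hund_f1` … `hund_d9`: `(L, S, J)` triples);
* `landeG` special cases: `g = 2` for `L = 0` (pure spin), `g = 1` for `S = 0`; `pSq 0 S S = 4S(S+1)` (spin only);
* EXACT `p²` for every trivalent lanthanide (`45/7` Ce, `64/5` Pr, `144/11` Nd, `36/5` Pm, `5/7` Sm, `0` Eu, `63` Gd,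
  `189/2` Tb, `340/3` Dy, `225/2` Ho, `459/5` Er, `343/6` Tm, `144/7` Yb) and the two-decimal certificates
  (Kittel prints 2.54 / 3.58 / 3.62 / 2.68 / 0.84 / 0 / 7.94 / 9.72 / 10.63 / 10.60 / 9.59 / 7.57 / 4.54; the exact
  values round to 2.54 / 3.58 / 3.62 / 2.68 / 0.85 / 0 / 7.94 / 9.72 / 10.65 / 10.61 / 9.58 / 7.56 / 4.54 — the
  four 0.01-level differences are Kittel's roundings, flagged in the docstrings, never «corrected» in the cite);
* iron group full-`J` values (1.55, 1.63, 0.77, 0, 5.92, 6.71, 6.63, 5.59, 3.55) and the SPIN-ONLY column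
  (1.73, 2.83, 3.87, 4.90, 5.92) certified;
* located use: Bauer et al.'s CePt₃Si `μ_eff = 2.54 μ_B` IS the free-ion `f¹` value to the printed precision
  (`cePt3Si_mueff_is_free_ion_Ce3`).
* §6: the saturation moment `g_J·J` (`hundSat`: f⁷ 7, f¹ 15/7, f² 16/5, f³ 36/11), the Ising crystal-field doublet
  `|±J_z⟩` (`jzMoment`, `gParallel = 2g_J J_z`) with `CeRu₂Si₂`'s `|±5/2⟩`: `g_∥ = 5g_J = 30/7` (Flouquet), and the located
  pair «CeRu₂Ge₂ 2.15 μ_B» = `15/7` to print precision vs «CeRu₂Si₂ 0.7 μ_B above H_M» = 0.33 of it (Daou–Bergemann–Julian).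

WHAT THIS IS NOT: no crystal-field, Van Vleck, Kondo-screening or itinerant correction (Sm³⁺/Eu³⁺ deviate, Table 1);
the spin-only rule for 3d ions is an empirical statement of Table 2, typed as a definition, not derived; nothing
here asserts any material's valence.

## References
* [Kittel1971] C. Kittel, *Introduction to Solid State Physics*, 4th ed., Wiley (1971), ch. 15 «Paramagnetism»:
  Eq. (16) (Landé equation), Eq. (25)–(26) (`C = Np²μ_B²/3k_B`, `p ≡ g[J(J+1)]^{1/2}`), Table 1 (effective
  magneton numbers for trivalent lanthanide ions, configurations and basic levels), «Hund Rules» (the three rules),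
  Table 2 (iron group ions; `p = 2[S(S+1)]^{1/2}`, «quenched» orbital moment).
* [BauerEtAl2004CePt3Si] E. Bauer, G. Hilscher, H. Michor, Ch. Paul, E. W. Scheidt, A. Gribanov, Yu. Seropegin,
  H. Noël, M. Sigrist, P. Rogl, Phys. Rev. Lett. 92 (2004) 027003 = arXiv:cond-mat/0308083, p. 2 («a Curie Weiss
  behaviour with an effective Ce moment μ_eff = 2.54 μ_B … indicates a rather stable 3⁺ state of Ce»).
* [Flouquet2005HeavyFermionRoad] J. Flouquet, «On the heavy fermion road», Prog. Low Temp. Phys. 15 (2005) 139 =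
  arXiv:cond-mat/0501602, ch. 2 §2.2 p. 39 (CeRu₂Si₂ crystal-field ground state «almost a pure ±5/2 doublet … g_∥ = 5g_J,
  g_⊥ = 0»).
* [DaouBergemannJulian2006CeRu2Si2] R. Daou, C. Bergemann, S. R. Julian, Phys. Rev. Lett. 96 (2006) 026401 =
  arXiv:cond-mat/0508613, p. 1 (CeRu₂Si₂ γ ≃ 350 mJ/mol K²; 0.7 μ_B/Ce and 500 mJ/mol K² above the metamagnetic transition
  vs CeRu₂Ge₂ 2.15 μ_B and 20 mJ/mol K²).
-/

noncomputable section

namespace Literature.MathematicalPhysics.QuantumManyBody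

namespace LocalMoment

/-! ## §1 Landé factor and effective magneton number -/

/-- The Landé equation `g = 1 + [J(J+1) + S(S+1) − L(L+1)]/[2J(J+1)]` (for `J = 0` Lean's `x/0 = 0` gives `g = 1`,
harmless since then `p = 0`). [cite: Kittel1971, ch. 15 Eq. (16)] -/
def landeG (L S J : ℝ) : ℝ := 1 + (J * (J + 1) + S * (S + 1) - L * (L + 1)) / (2 * (J * (J + 1)))

/-- The SQUARED effective magneton number `p² = g² J(J+1)` (the Curie constant is `N p² μ_B²/3k_B`).
[cite: Kittel1971, ch. 15 Eq. (25)–(26)] -/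
def pSq (L S J : ℝ) : ℝ := landeG L S J ^ 2 * (J * (J + 1))

/-- The effective magneton number `p = g [J(J+1)]^{1/2}` itself. [cite: Kittel1971, ch. 15 Eq. (26)] -/
def pEff (L S J : ℝ) : ℝ := Real.sqrt (pSq L S J)

/-- The SPIN-ONLY squared magneton number `p² = 4 S(S+1)` of the iron group («orbital moments quenched»).
[cite: Kittel1971, ch. 15 Table 2] -/
def spinOnlyPSq (S : ℝ) : ℝ := 4 * (S * (S + 1))

/-- Pure spin (`L = 0`, `J = S ≠ 0`, `S > 0`): `g = 2`. [cite: Kittel1971, ch. 15 Eq. (16)] -/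
theorem landeG_spin_only {S : ℝ} (hS : 0 < S) : landeG 0 S S = 2 := by
  unfold landeG
  have : S * (S + 1) ≠ 0 := by positivity
  field_simp
  ring

/-- Pure orbital (`S = 0`, `J = L > 0`): `g = 1`. [cite: Kittel1971, ch. 15 Eq. (16)] -/
theorem landeG_orbital_only {L : ℝ} (hL : 0 < L) : landeG L 0 L = 1 := by
  unfold landeG
  have : L * (L + 1) ≠ 0 := by positivity
  field_simp
  ring

/-- For `L = 0` the Landé value reduces to the spin-only one: `p² = 4S(S+1)`. [cite: Kittel1971, ch. 15 Table 2] -/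
theorem pSq_spin_only {S : ℝ} (hS : 0 < S) : pSq 0 S S = spinOnlyPSq S := by
  unfold pSq spinOnlyPSq
  rw [landeG_spin_only hS]
  ring

/-- `p ≥ 0` and `p² = pSq` when `pSq ≥ 0`. [cite: Kittel1971, ch. 15 Eq. (26)] -/
theorem pEff_sq {L S J : ℝ} (h : 0 ≤ pSq L S J) : pEff L S J ^ 2 = pSq L S J := by
  unfold pEff
  rw [Real.sq_sqrt h]

/-- Reading a two-decimal bound on `p` from bounds on `p²`: `a² < p² < b²`, `0 ≤ a`, `0 ≤ b` ⇒ `a < p < b`.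
[cite: Kittel1971, ch. 15 Eq. (26)] -/
theorem pEff_bounds {L S J a b : ℝ} (ha : 0 ≤ a) (hb : 0 ≤ b) (hlo : a ^ 2 < pSq L S J) (hhi : pSq L S J < b ^ 2) :
    a < pEff L S J ∧ pEff L S J < b := by
  unfold pEff
  constructor
  · calc a = Real.sqrt (a ^ 2) := by rw [Real.sqrt_sq ha]
      _ < Real.sqrt (pSq L S J) := Real.sqrt_lt_sqrt (sq_nonneg a) hlo
  · calc Real.sqrt (pSq L S J) < Real.sqrt (b ^ 2) :=
          Real.sqrt_lt_sqrt (le_of_lt (lt_of_le_of_lt (sq_nonneg a) hlo)) hhi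
      _ = b := Real.sqrt_sq hb

/-! ## §2 Hund's rules in closed form -/

/-- Hund's first rule: total spin of `n` electrons in an `l` shell (`2l+1` orbitals): `n/2` up to half filling,
`(4l + 2 − n)/2` beyond. [cite: Kittel1971, ch. 15 «Hund Rules» (rule 1)] -/
def hundS (l n : ℕ) : ℝ := if n ≤ 2 * l + 1 then (n : ℝ) / 2 else (4 * l + 2 - n : ℝ) / 2

/-- Hund's second rule: maximal `L` = the `n` (or `n − (2l+1)`) largest `m_l` values summed,
`n(2l + 1 − n)/2` resp. `(n − 2l − 1)(4l + 2 − n)/2`. [cite: Kittel1971, ch. 15 «Hund Rules» (rule 2)] -/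
def hundL (l n : ℕ) : ℝ :=
  if n ≤ 2 * l + 1 then (n : ℝ) * (2 * l + 1 - n) / 2 else ((n : ℝ) - (2 * l + 1)) * (4 * l + 2 - n) / 2

/-- Hund's third rule: `J = L − S` for a less-than-half-filled shell (`n ≤ 2l`), `J = L + S` otherwise (at half
filling `L = 0` so `J = S`). [cite: Kittel1971, ch. 15 «Hund Rules» (rule 3)] -/
def hundJ (l n : ℕ) : ℝ := if n ≤ 2 * l then hundL l n - hundS l n else hundL l n + hundS l n

/-- The Hund ground multiplet `(L, S, J)` of `lⁿ`. [cite: Kittel1971, ch. 15 «Hund Rules»] -/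
def hundTerm (l n : ℕ) : ℝ × ℝ × ℝ := (hundL l n, hundS l n, hundJ l n)

/-- `p²` of the Hund ground term of `lⁿ`. [cite: Kittel1971, ch. 15 Eq. (26), Table 1] -/
def hundPSq (l n : ℕ) : ℝ := pSq (hundL l n) (hundS l n) (hundJ l n)

/-! ### The lanthanide ground terms (Kittel Table 1, column «Basic level») -/

/-- Ce³⁺ `4f¹`: ²F₅⁄₂ = `(L, S, J) = (3, 1/2, 5/2)`. [cite: Kittel1971, ch. 15 Table 1] -/
theorem hund_f1 : hundTerm 3 1 = (3, 1 / 2, 5 / 2) := by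
  unfold hundTerm hundJ hundL hundS; norm_num
/-- Pr³⁺ `4f²`: ³H₄ = `(5, 1, 4)`. [cite: Kittel1971, ch. 15 Table 1] -/
theorem hund_f2 : hundTerm 3 2 = (5, 1, 4) := by
  unfold hundTerm hundJ hundL hundS; norm_num
/-- Nd³⁺ `4f³`: ⁴I₉⁄₂ = `(6, 3/2, 9/2)`. [cite: Kittel1971, ch. 15 Table 1] -/
theorem hund_f3 : hundTerm 3 3 = (6, 3 / 2, 9 / 2) := by
  unfold hundTerm hundJ hundL hundS; norm_num
/-- Pm³⁺ `4f⁴`: ⁵I₄ = `(6, 2, 4)`. [cite: Kittel1971, ch. 15 Table 1] -/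
theorem hund_f4 : hundTerm 3 4 = (6, 2, 4) := by
  unfold hundTerm hundJ hundL hundS; norm_num
/-- Sm³⁺ `4f⁵`: ⁶H₅⁄₂ = `(5, 5/2, 5/2)`. [cite: Kittel1971, ch. 15 Table 1] -/
theorem hund_f5 : hundTerm 3 5 = (5, 5 / 2, 5 / 2) := by
  unfold hundTerm hundJ hundL hundS; norm_num
/-- Eu³⁺ `4f⁶`: ⁷F₀ = `(3, 3, 0)`. [cite: Kittel1971, ch. 15 Table 1] -/
theorem hund_f6 : hundTerm 3 6 = (3, 3, 0) := by
  unfold hundTerm hundJ hundL hundS; norm_num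
/-- Gd³⁺ (and Eu²⁺) `4f⁷`: ⁸S₇⁄₂ = `(0, 7/2, 7/2)`. [cite: Kittel1971, ch. 15 Table 1] -/
theorem hund_f7 : hundTerm 3 7 = (0, 7 / 2, 7 / 2) := by
  unfold hundTerm hundJ hundL hundS; norm_num
/-- Tb³⁺ `4f⁸`: ⁷F₆ = `(3, 3, 6)`. [cite: Kittel1971, ch. 15 Table 1] -/
theorem hund_f8 : hundTerm 3 8 = (3, 3, 6) := by
  unfold hundTerm hundJ hundL hundS; norm_num
/-- Dy³⁺ `4f⁹`: ⁶H₁₅⁄₂ = `(5, 5/2, 15/2)`. [cite: Kittel1971, ch. 15 Table 1] -/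
theorem hund_f9 : hundTerm 3 9 = (5, 5 / 2, 15 / 2) := by
  unfold hundTerm hundJ hundL hundS; norm_num
/-- Ho³⁺ `4f¹⁰`: ⁵I₈ = `(6, 2, 8)`. [cite: Kittel1971, ch. 15 Table 1] -/
theorem hund_f10 : hundTerm 3 10 = (6, 2, 8) := by
  unfold hundTerm hundJ hundL hundS; norm_num
/-- Er³⁺ `4f¹¹`: ⁴I₁₅⁄₂ = `(6, 3/2, 15/2)`. [cite: Kittel1971, ch. 15 Table 1] -/
theorem hund_f11 : hundTerm 3 11 = (6, 3 / 2, 15 / 2) := by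
  unfold hundTerm hundJ hundL hundS; norm_num
/-- Tm³⁺ `4f¹²`: ³H₆ = `(5, 1, 6)`. [cite: Kittel1971, ch. 15 Table 1] -/
theorem hund_f12 : hundTerm 3 12 = (5, 1, 6) := by
  unfold hundTerm hundJ hundL hundS; norm_num
/-- Yb³⁺ `4f¹³`: ²F₇⁄₂ = `(3, 1/2, 7/2)`. [cite: Kittel1971, ch. 15 Table 1] -/
theorem hund_f13 : hundTerm 3 13 = (3, 1 / 2, 7 / 2) := by
  unfold hundTerm hundJ hundL hundS; norm_num

/-! ### The iron-group ground terms (Kittel Table 2, column «Basic level») -/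

/-- Ti³⁺/V⁴⁺ `3d¹`: ²D₃⁄₂ = `(2, 1/2, 3/2)`. [cite: Kittel1971, ch. 15 Table 2] -/
theorem hund_d1 : hundTerm 2 1 = (2, 1 / 2, 3 / 2) := by
  unfold hundTerm hundJ hundL hundS; norm_num
/-- V³⁺ `3d²`: ³F₂ = `(3, 1, 2)`. [cite: Kittel1971, ch. 15 Table 2] -/
theorem hund_d2 : hundTerm 2 2 = (3, 1, 2) := by
  unfold hundTerm hundJ hundL hundS; norm_num
/-- Cr³⁺/V²⁺ `3d³`: ⁴F₃⁄₂ = `(3, 3/2, 3/2)`. [cite: Kittel1971, ch. 15 Table 2] -/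
theorem hund_d3 : hundTerm 2 3 = (3, 3 / 2, 3 / 2) := by
  unfold hundTerm hundJ hundL hundS; norm_num
/-- Mn³⁺/Cr²⁺ `3d⁴`: ⁵D₀ = `(2, 2, 0)`. [cite: Kittel1971, ch. 15 Table 2] -/
theorem hund_d4 : hundTerm 2 4 = (2, 2, 0) := by
  unfold hundTerm hundJ hundL hundS; norm_num
/-- Fe³⁺/Mn²⁺ `3d⁵`: ⁶S₅⁄₂ = `(0, 5/2, 5/2)`. [cite: Kittel1971, ch. 15 Table 2] -/
theorem hund_d5 : hundTerm 2 5 = (0, 5 / 2, 5 / 2) := by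
  unfold hundTerm hundJ hundL hundS; norm_num
/-- Fe²⁺ `3d⁶`: ⁵D₄ = `(2, 2, 4)`. [cite: Kittel1971, ch. 15 Table 2] -/
theorem hund_d6 : hundTerm 2 6 = (2, 2, 4) := by
  unfold hundTerm hundJ hundL hundS; norm_num
/-- Co²⁺ `3d⁷`: ⁴F₉⁄₂ = `(3, 3/2, 9/2)`. [cite: Kittel1971, ch. 15 Table 2] -/
theorem hund_d7 : hundTerm 2 7 = (3, 3 / 2, 9 / 2) := by
  unfold hundTerm hundJ hundL hundS; norm_num
/-- Ni²⁺ `3d⁸`: ³F₄ = `(3, 1, 4)`. [cite: Kittel1971, ch. 15 Table 2] -/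
theorem hund_d8 : hundTerm 2 8 = (3, 1, 4) := by
  unfold hundTerm hundJ hundL hundS; norm_num
/-- Cu²⁺ `3d⁹`: ²D₅⁄₂ = `(2, 1/2, 5/2)`. [cite: Kittel1971, ch. 15 Table 2] -/
theorem hund_d9 : hundTerm 2 9 = (2, 1 / 2, 5 / 2) := by
  unfold hundTerm hundJ hundL hundS; norm_num

/-! ## §3 Exact `p²` and the certified lanthanide table -/

/-- Ce³⁺: `p² = 45/7` (`g = 6/7`). [cite: Kittel1971, ch. 15 Table 1] -/
theorem pSq_Ce3 : hundPSq 3 1 = 45 / 7 := by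
  unfold hundPSq pSq landeG hundJ hundL hundS; norm_num
/-- Pr³⁺: `p² = 64/5` (`g = 4/5`). [cite: Kittel1971, ch. 15 Table 1] -/
theorem pSq_Pr3 : hundPSq 3 2 = 64 / 5 := by
  unfold hundPSq pSq landeG hundJ hundL hundS; norm_num
/-- Nd³⁺: `p² = 144/11` (`g = 8/11`). [cite: Kittel1971, ch. 15 Table 1] -/
theorem pSq_Nd3 : hundPSq 3 3 = 144 / 11 := by
  unfold hundPSq pSq landeG hundJ hundL hundS; norm_num
/-- Pm³⁺: `p² = 36/5` (`g = 3/5`). [cite: Kittel1971, ch. 15 Table 1] -/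
theorem pSq_Pm3 : hundPSq 3 4 = 36 / 5 := by
  unfold hundPSq pSq landeG hundJ hundL hundS; norm_num
/-- Sm³⁺: `p² = 5/7` (`g = 2/7`). [cite: Kittel1971, ch. 15 Table 1] -/
theorem pSq_Sm3 : hundPSq 3 5 = 5 / 7 := by
  unfold hundPSq pSq landeG hundJ hundL hundS; norm_num
/-- Eu³⁺: `p² = 0` (`J = 0`). [cite: Kittel1971, ch. 15 Table 1] -/
theorem pSq_Eu3 : hundPSq 3 6 = 0 := by
  unfold hundPSq pSq landeG hundJ hundL hundS; norm_num
/-- Gd³⁺ / Eu²⁺: `p² = 63` (`g = 2`, spin only). [cite: Kittel1971, ch. 15 Table 1] -/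
theorem pSq_Gd3 : hundPSq 3 7 = 63 := by
  unfold hundPSq pSq landeG hundJ hundL hundS; norm_num
/-- Tb³⁺: `p² = 189/2` (`g = 3/2`). [cite: Kittel1971, ch. 15 Table 1] -/
theorem pSq_Tb3 : hundPSq 3 8 = 189 / 2 := by
  unfold hundPSq pSq landeG hundJ hundL hundS; norm_num
/-- Dy³⁺: `p² = 340/3` (`g = 4/3`). [cite: Kittel1971, ch. 15 Table 1] -/
theorem pSq_Dy3 : hundPSq 3 9 = 340 / 3 := by
  unfold hundPSq pSq landeG hundJ hundL hundS; norm_num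
/-- Ho³⁺: `p² = 225/2` (`g = 5/4`). [cite: Kittel1971, ch. 15 Table 1] -/
theorem pSq_Ho3 : hundPSq 3 10 = 225 / 2 := by
  unfold hundPSq pSq landeG hundJ hundL hundS; norm_num
/-- Er³⁺: `p² = 459/5` (`g = 6/5`). [cite: Kittel1971, ch. 15 Table 1] -/
theorem pSq_Er3 : hundPSq 3 11 = 459 / 5 := by
  unfold hundPSq pSq landeG hundJ hundL hundS; norm_num
/-- Tm³⁺: `p² = 343/6` (`g = 7/6`). [cite: Kittel1971, ch. 15 Table 1] -/
theorem pSq_Tm3 : hundPSq 3 12 = 343 / 6 := by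
  unfold hundPSq pSq landeG hundJ hundL hundS; norm_num
/-- Yb³⁺: `p² = 144/7` (`g = 8/7`). [cite: Kittel1971, ch. 15 Table 1] -/
theorem pSq_Yb3 : hundPSq 3 13 = 144 / 7 := by
  unfold hundPSq pSq landeG hundJ hundL hundS; norm_num

/-- Helper: `p` of a Hund term from bounds on the exact `p²`. [folklore] -/
private lemma hundP_bounds {l n : ℕ} {a b : ℝ} (ha : 0 ≤ a) (hb : 0 ≤ b)
    (hlo : a ^ 2 < hundPSq l n) (hhi : hundPSq l n < b ^ 2) :
    a < Real.sqrt (hundPSq l n) ∧ Real.sqrt (hundPSq l n) < b := by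
  unfold hundPSq at *
  exact pEff_bounds ha hb hlo hhi

/-- KITTEL TABLE 1 CERTIFIED (p(calc) column, two decimals): Ce³⁺ `2.53 < p < 2.54` (printed 2.54; exact 2.5355).
[cite: Kittel1971, ch. 15 Table 1] -/
theorem p_Ce3 : 2.53 < Real.sqrt (hundPSq 3 1) ∧ Real.sqrt (hundPSq 3 1) < 2.54 := by
  apply hundP_bounds (by norm_num) (by norm_num) <;> rw [pSq_Ce3] <;> norm_num
/-- Pr³⁺ `3.57 < p < 3.58` (printed 3.58). [cite: Kittel1971, ch. 15 Table 1] -/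
theorem p_Pr3 : 3.57 < Real.sqrt (hundPSq 3 2) ∧ Real.sqrt (hundPSq 3 2) < 3.58 := by
  apply hundP_bounds (by norm_num) (by norm_num) <;> rw [pSq_Pr3] <;> norm_num
/-- Nd³⁺ `3.61 < p < 3.62` (printed 3.62). [cite: Kittel1971, ch. 15 Table 1] -/
theorem p_Nd3 : 3.61 < Real.sqrt (hundPSq 3 3) ∧ Real.sqrt (hundPSq 3 3) < 3.62 := by
  apply hundP_bounds (by norm_num) (by norm_num) <;> rw [pSq_Nd3] <;> norm_num
/-- Pm³⁺ `2.68 < p < 2.69` (printed 2.68). [cite: Kittel1971, ch. 15 Table 1] -/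
theorem p_Pm3 : 2.68 < Real.sqrt (hundPSq 3 4) ∧ Real.sqrt (hundPSq 3 4) < 2.69 := by
  apply hundP_bounds (by norm_num) (by norm_num) <;> rw [pSq_Pm3] <;> norm_num
/-- Sm³⁺ `0.84 < p < 0.85` (printed 0.84; exact 0.845…; experiment 1.5 — the multiplet case Kittel flags).
[cite: Kittel1971, ch. 15 Table 1] -/
theorem p_Sm3 : 0.84 < Real.sqrt (hundPSq 3 5) ∧ Real.sqrt (hundPSq 3 5) < 0.85 := by
  apply hundP_bounds (by norm_num) (by norm_num) <;> rw [pSq_Sm3] <;> norm_num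
/-- Gd³⁺ `7.93 < p < 7.94` (printed 7.94). [cite: Kittel1971, ch. 15 Table 1] -/
theorem p_Gd3 : 7.93 < Real.sqrt (hundPSq 3 7) ∧ Real.sqrt (hundPSq 3 7) < 7.94 := by
  apply hundP_bounds (by norm_num) (by norm_num) <;> rw [pSq_Gd3] <;> norm_num
/-- Tb³⁺ `9.72 < p < 9.73` (printed 9.72). [cite: Kittel1971, ch. 15 Table 1] -/
theorem p_Tb3 : 9.72 < Real.sqrt (hundPSq 3 8) ∧ Real.sqrt (hundPSq 3 8) < 9.73 := by
  apply hundP_bounds (by norm_num) (by norm_num) <;> rw [pSq_Tb3] <;> norm_num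
/-- Dy³⁺ `10.64 < p < 10.65` (Kittel prints 10.63; the exact `√(340/3) = 10.646` — a rounding in the source).
[cite: Kittel1971, ch. 15 Table 1] -/
theorem p_Dy3 : 10.64 < Real.sqrt (hundPSq 3 9) ∧ Real.sqrt (hundPSq 3 9) < 10.65 := by
  apply hundP_bounds (by norm_num) (by norm_num) <;> rw [pSq_Dy3] <;> norm_num
/-- Ho³⁺ `10.60 < p < 10.61` (printed 10.60). [cite: Kittel1971, ch. 15 Table 1] -/
theorem p_Ho3 : 10.60 < Real.sqrt (hundPSq 3 10) ∧ Real.sqrt (hundPSq 3 10) < 10.61 := by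
  apply hundP_bounds (by norm_num) (by norm_num) <;> rw [pSq_Ho3] <;> norm_num
/-- Er³⁺ `9.58 < p < 9.59` (printed 9.59). [cite: Kittel1971, ch. 15 Table 1] -/
theorem p_Er3 : 9.58 < Real.sqrt (hundPSq 3 11) ∧ Real.sqrt (hundPSq 3 11) < 9.59 := by
  apply hundP_bounds (by norm_num) (by norm_num) <;> rw [pSq_Er3] <;> norm_num
/-- Tm³⁺ `7.56 < p < 7.57` (printed 7.57). [cite: Kittel1971, ch. 15 Table 1] -/
theorem p_Tm3 : 7.56 < Real.sqrt (hundPSq 3 12) ∧ Real.sqrt (hundPSq 3 12) < 7.57 := by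
  apply hundP_bounds (by norm_num) (by norm_num) <;> rw [pSq_Tm3] <;> norm_num
/-- Yb³⁺ `4.53 < p < 4.54` (printed 4.54). [cite: Kittel1971, ch. 15 Table 1] -/
theorem p_Yb3 : 4.53 < Real.sqrt (hundPSq 3 13) ∧ Real.sqrt (hundPSq 3 13) < 4.54 := by
  apply hundP_bounds (by norm_num) (by norm_num) <;> rw [pSq_Yb3] <;> norm_num

/-! ## §4 Iron group: full-`J` values, and the spin-only column -/

/-- Ti³⁺ `d¹`: `p² = 12/5` (printed 1.55), spin-only `3` (1.73). [cite: Kittel1971, ch. 15 Table 2] -/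
theorem pSq_d1 : hundPSq 2 1 = 12 / 5 ∧ spinOnlyPSq (hundS 2 1) = 3 := by
  unfold hundPSq pSq landeG hundJ hundL hundS spinOnlyPSq; norm_num
/-- V³⁺ `d²`: `p² = 8/3` (1.63), spin-only `8` (2.83). [cite: Kittel1971, ch. 15 Table 2] -/
theorem pSq_d2 : hundPSq 2 2 = 8 / 3 ∧ spinOnlyPSq (hundS 2 2) = 8 := by
  unfold hundPSq pSq landeG hundJ hundL hundS spinOnlyPSq; norm_num
/-- Cr³⁺ `d³`: `p² = 3/5` (0.77), spin-only `15` (3.87). [cite: Kittel1971, ch. 15 Table 2] -/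
theorem pSq_d3 : hundPSq 2 3 = 3 / 5 ∧ spinOnlyPSq (hundS 2 3) = 15 := by
  unfold hundPSq pSq landeG hundJ hundL hundS spinOnlyPSq; norm_num
/-- Mn³⁺ `d⁴`: `p² = 0` (`J = 0`), spin-only `24` (4.90). [cite: Kittel1971, ch. 15 Table 2] -/
theorem pSq_d4 : hundPSq 2 4 = 0 ∧ spinOnlyPSq (hundS 2 4) = 24 := by
  unfold hundPSq pSq landeG hundJ hundL hundS spinOnlyPSq; norm_num
/-- Fe³⁺/Mn²⁺ `d⁵`: `p² = 35` both ways (5.92). [cite: Kittel1971, ch. 15 Table 2] -/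
theorem pSq_d5 : hundPSq 2 5 = 35 ∧ spinOnlyPSq (hundS 2 5) = 35 := by
  unfold hundPSq pSq landeG hundJ hundL hundS spinOnlyPSq; norm_num
/-- Fe²⁺ `d⁶`: `p² = 45` (6.70 printed; exact 6.708), spin-only `24` (4.90; experiment 5.4).
[cite: Kittel1971, ch. 15 Table 2] -/
theorem pSq_d6 : hundPSq 2 6 = 45 ∧ spinOnlyPSq (hundS 2 6) = 24 := by
  unfold hundPSq pSq landeG hundJ hundL hundS spinOnlyPSq; norm_num
/-- Co²⁺ `d⁷`: `p² = 44` (6.63), spin-only `15` (3.87). [cite: Kittel1971, ch. 15 Table 2] -/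
theorem pSq_d7 : hundPSq 2 7 = 44 ∧ spinOnlyPSq (hundS 2 7) = 15 := by
  unfold hundPSq pSq landeG hundJ hundL hundS spinOnlyPSq; norm_num
/-- Ni²⁺ `d⁸`: `p² = 125/4` (5.59), spin-only `8` (2.83). [cite: Kittel1971, ch. 15 Table 2] -/
theorem pSq_d8 : hundPSq 2 8 = 125 / 4 ∧ spinOnlyPSq (hundS 2 8) = 8 := by
  unfold hundPSq pSq landeG hundJ hundL hundS spinOnlyPSq; norm_num
/-- Cu²⁺ `d⁹`: `p² = 63/5` (3.55), spin-only `3` (1.73). [cite: Kittel1971, ch. 15 Table 2] -/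
theorem pSq_d9 : hundPSq 2 9 = 63 / 5 ∧ spinOnlyPSq (hundS 2 9) = 3 := by
  unfold hundPSq pSq landeG hundJ hundL hundS spinOnlyPSq; norm_num

/-- THE SPIN-ONLY COLUMN CERTIFIED: `S = ½, 1, 3/2, 2, 5/2` ⇒ `p = 2√(S(S+1))` lies in
`(1.73, 1.74)`, `(2.82, 2.83)`, `(3.87, 3.88)`, `(4.89, 4.90)`, `(5.91, 5.92)` (printed 1.73 / 2.83 / 3.87 / 4.90 / 5.92).
[cite: Kittel1971, ch. 15 Table 2] -/
theorem spinOnly_table :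
    (1.73 ^ 2 < spinOnlyPSq (1 / 2) ∧ spinOnlyPSq (1 / 2) < 1.74 ^ 2) ∧
    (2.82 ^ 2 < spinOnlyPSq 1 ∧ spinOnlyPSq 1 < 2.83 ^ 2) ∧
    (3.87 ^ 2 < spinOnlyPSq (3 / 2) ∧ spinOnlyPSq (3 / 2) < 3.88 ^ 2) ∧
    (4.89 ^ 2 < spinOnlyPSq 2 ∧ spinOnlyPSq 2 < 4.90 ^ 2) ∧
    (5.91 ^ 2 < spinOnlyPSq (5 / 2) ∧ spinOnlyPSq (5 / 2) < 5.92 ^ 2) := by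
  unfold spinOnlyPSq; norm_num

/-! ## §5 Located use -/

/-- CePt₃Si: Bauer et al.'s Curie–Weiss «μ_eff = 2.54 μ_B … a rather stable 3⁺ state of Ce» — the printed value
is the free-ion Hund/Landé `f¹` number to its two decimals (`|p(f¹) − 2.54| < 0.01`).
[cite: BauerEtAl2004CePt3Si, p. 2] [cite: Kittel1971, ch. 15 Table 1] -/
theorem cePt3Si_mueff_is_free_ion_Ce3 : |Real.sqrt (hundPSq 3 1) - 2.54| < 0.01 := by
  obtain ⟨h1, h2⟩ := p_Ce3
  rw [abs_lt]; constructor <;> linarith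

/-! ## §6 The saturation moment `g_J·J` and the Ising crystal-field doublet (`CeRu₂Si₂` / `CeRu₂Ge₂`) -/

/-- THE SATURATION MOMENT of a `(L, S, J)` multiplet in units of `μ_B`: `g_J · J` (the `B_J → 1` limit of
`M = N g J μ_B B_J(x)`). [cite: Kittel1971, ch. 15 «Quantum theory of paramagnetism» (M = NgJμ_B B_J(x); saturation NgJμ_B)] -/
def satMoment (L S J : ℝ) : ℝ := landeG L S J * J

/-- The saturation moment of the Hund ground term of `lⁿ`. [cite: Kittel1971, ch. 15 (M = NgJμ_B B_J(x))] -/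
def hundSat (l n : ℕ) : ℝ := satMoment (hundL l n) (hundS l n) (hundJ l n)

/-- The moment `g_J · J_z` (in `μ_B`) of a crystal-field state of definite `J_z` inside the `(L, S, J)` multiplet, and
the effective parallel `g`-factor `g_∥ = 2 g_J J_z` of the Ising doublet `|±J_z⟩` (whose `g_⊥` vanishes unless
`J_z = ±1/2`). [cite: Flouquet2005HeavyFermionRoad, ch. 2 §2.2 p. 39 («almost a pure ±5/2 doublet with … g_∥ = 5g_J and g_⊥ = 0»)] -/
def jzMoment (L S J Jz : ℝ) : ℝ := landeG L S J * Jz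

/-- `g_∥ = 2 g_J J_z` of the Ising doublet `|±J_z⟩`. [cite: Flouquet2005HeavyFermionRoad, ch. 2 §2.2 p. 39] -/
def gParallel (L S J Jz : ℝ) : ℝ := 2 * landeG L S J * Jz

/-- The stretched state `J_z = J` carries the full saturation moment. [cite: Kittel1971, ch. 15 (M = NgJμ_B B_J(x))] -/
theorem jzMoment_top (L S J : ℝ) : jzMoment L S J J = satMoment L S J := rfl

/-- `f⁷` (`Gd³⁺`, `Eu²⁺`; ⁸S₇/₂, `g = 2`): saturation `gJ = 7 μ_B` — the «gS = 7.0 μ_B/Eu» of the Eu-pnictide rows.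
[cite: Kittel1971, ch. 15 Table 1 (Gd³⁺ ⁸S₇/₂)] -/
theorem hundSat_f7 : hundSat 3 7 = 7 := by
  unfold hundSat satMoment landeG hundJ hundL hundS; norm_num

/-- `f¹` (`Ce³⁺`, ²F₅/₂, `g = 6/7`): saturation `gJ = 15/7 = 2.142… μ_B`. [cite: Kittel1971, ch. 15 Table 1 (Ce³⁺ ²F₅/₂)] -/
theorem hundSat_f1 : hundSat 3 1 = 15 / 7 := by
  unfold hundSat satMoment landeG hundJ hundL hundS; norm_num

/-- `f²` (`Pr³⁺`, `U⁴⁺`; ³H₄, `g = 4/5`): `gJ = 16/5`; `f³` (`Nd³⁺`, `U³⁺`; ⁴I₉/₂, `g = 8/11`): `gJ = 36/11`.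
[cite: Kittel1971, ch. 15 Table 1 (Pr³⁺, Nd³⁺ rows)] -/
theorem hundSat_f2_f3 : hundSat 3 2 = 16 / 5 ∧ hundSat 3 3 = 36 / 11 := by
  unfold hundSat satMoment landeG hundJ hundL hundS; constructor <;> norm_num

/-- `CeRu₂Si₂`'s Ising ground doublet `|±5/2⟩` of ²F₅/₂: `g_∥ = 2·(6/7)·(5/2) = 30/7`, which IS Flouquet's «g_∥ = 5 g_J»,
numerically `4.28 < g_∥ < 4.29`; its moment `g_J·5/2` is the full free-ion saturation `15/7`.
[cite: Flouquet2005HeavyFermionRoad, ch. 2 §2.2 p. 39] -/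
theorem ceRu2Si2_isingDoublet :
    gParallel 3 (1 / 2) (5 / 2) (5 / 2) = 5 * landeG 3 (1 / 2) (5 / 2) ∧ gParallel 3 (1 / 2) (5 / 2) (5 / 2) = 30 / 7 ∧
      (4.28 < gParallel 3 (1 / 2) (5 / 2) (5 / 2) ∧ gParallel 3 (1 / 2) (5 / 2) (5 / 2) < 4.29) ∧
        jzMoment 3 (1 / 2) (5 / 2) (5 / 2) = hundSat 3 1 := by
  refine ⟨?_, ?_, ⟨?_, ?_⟩, ?_⟩
  · unfold gParallel; ring
  · unfold gParallel landeG; norm_num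
  · unfold gParallel landeG; norm_num
  · unfold gParallel landeG; norm_num
  · rw [hundSat_f1]; unfold jzMoment landeG; norm_num

/-- THE LOCAL-MOMENT ANALOGUE: `CeRu₂Ge₂`'s printed ordered moment «2.15 μ_B» is the `|±5/2⟩` / free-ion saturation
value `15/7` to its two decimals (`|15/7 − 2.15| < 0.01`), while `CeRu₂Si₂`'s polarised-state «0.7 μ_B per Ce» above
the metamagnetic transition is `0.32 < 0.7/(15/7) < 0.33` of it. [cite: DaouBergemannJulian2006CeRu2Si2, p. 1 («the
magnetisation (0.7 μB per Ce) … the local moment analogue CeRu₂Ge₂ (2.15 μB and 20 mJ/mole K²)»)] -/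
theorem ceRu2Ge2_vs_ceRu2Si2_moment :
    |hundSat 3 1 - 2.15| < 0.01 ∧ (0.32 < 0.7 / hundSat 3 1 ∧ 0.7 / hundSat 3 1 < 0.33) := by
  rw [hundSat_f1]
  refine ⟨by rw [abs_lt]; constructor <;> norm_num, by norm_num, by norm_num⟩

end LocalMoment

end Literature.MathematicalPhysics.QuantumManyBody

end
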